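import Summits.FinalStateConjecture.FinalStateConjecture.Theses.SwallowTheDatum
import Literature.Geometry.Lorentzian.SmoothDataFamilyLocal

/-!
# Sketch — crux-ideate stmt-FinalStateConjecture-10051 (UniversalWitnessFamily), round 1, ideator 3

First lemmas of the three crux idea cards (they only need to ELABORATE; nothing is proved):

* `ParametricHarmonicTaming` — card `tame-the-end-first` (parametric Corvino–Schoen taming of a
  DR-admissible end to harmonic asymptotics, datum untouched on exhausting compacts);
* `TameEndScaleFreeSmall` — card `fire-the-pulse-into-the-far-field` (tame ends are scale-free
  small to every order on far annuli: the interface to short-pulse / Luk–Rodnianski incoming data);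
* `SchwarzschildMassPumpingCollar` — card `pump-the-mass-radially` (toy of the radial
  evolutionary-constraints collar: time-symmetric vacuum collar from Schwarzschild(m₀) to
  Schwarzschild(m₁), m₁ > m₀, Bartnik quasi-spherical + Corvino).
-/

open Literature.Geometry.Lorentzian
open scoped Manifold ContDiff Topology InnerProductSpace
open Filter Set

noncomputable section

namespace Summit.FinalStateConjecture.FinalStateConjecture.Cruxes.UniversalWitnessFamily.Ideator3

section Ends

variable {X : Type} [TopologicalSpace X] [ChartedSpace E3 X] [IsManifold (𝓡 3) ∞ X]

/-- **Harmonically flat end** (Corvino–Schoen harmonic asymptotics, arXiv:gr-qc/0301071, (1)/(2),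
read in the chart of the end `e`): outside coordinate radius `ρ` the metric components are
`h = u⁴ δ` and the momentum tensor `π := k − (tr_h k) h` is `u² (L_Y δ − (div Y) δ)` for a smooth
positive function `u` and a smooth vector field `Y`. (The reduced constraint system for `(u, Y)`
is implied by the vacuum constraints and is not restated.) -/
def IsHarmonicallyFlatEnd (e : AFEnd X) (D : InitialDataSet (𝓡 3) X) : Prop :=
  ∃ (ρ : ℝ) (u : E3 → ℝ) (Y : E3 → E3), e.R ≤ ρ ∧ ContDiff ℝ ∞ u ∧ ContDiff ℝ ∞ Y ∧
    (∀ x : E3, ρ < ‖x‖ → 0 < u x) ∧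
    ∀ x : E3, ρ < ‖x‖ → ∀ v w : E3,
      AFEnd.hCoeff e D x v w = (u x) ^ 4 * ⟪v, w⟫_ℝ ∧
      AFEnd.kCoeff e D x v w - AFEnd.trKCoeff e D x * AFEnd.hCoeff e D x v w =
        (u x) ^ 2 * (⟪fderiv ℝ Y x v, w⟫_ℝ + ⟪v, fderiv ℝ Y x w⟫_ℝ
          - LinearMap.trace ℝ E3 ((fderiv ℝ Y x : E3 →L[ℝ] E3) : E3 →ₗ[ℝ] E3) * ⟪v, w⟫_ℝ)

end Ends

/-- FIRST LEMMA of card `tame-the-end-first` — **parametric Corvino–Schoen taming.**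
Through every admissible datum `d` passes a smooth one-parameter family `G` of ADMISSIBLE data,
frozen at `d` near every point for small parameters (so `G c = d` on compacts exhausting `X`,
whence smoothness at `c = 0` by `IsSmoothDataFamily.of_eventuallyEq_zero`), all of whose members
`G c`, `c ≠ 0`, are harmonically flat on the (sole) end. Injectivity is NOT asked (the burial adds
distinct masses later). Print core: Corvino–Schoen, JDG 73 (2006) = gr-qc/0301071, Thm 1 and
Thm 4 (`W^{2,p}_{-δ} × W^{1,p}_{-1-δ}`, `p > 3` — a class containing the DR-admissible data, which
control exactly two derivatives of `h` and one of `k`). -/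
def ParametricHarmonicTaming : Prop :=
  ∀ (X : Type) [TopologicalSpace X] [ChartedSpace E3 X] [IsManifold (𝓡 3) ∞ X] [T2Space X]
    [SecondCountableTopology X] [ConnectedSpace X],
    ∀ d ∈ admissibleVacuumData X, ∃ G : EuclideanSpace ℝ (Fin 1) → InitialDataSet (𝓡 3) X,
      InitialDataSet.IsSmoothDataFamily 1 G ∧ G 0 = d ∧ (∀ c, G c ∈ admissibleVacuumData X) ∧
      (∀ x : X, ∀ᶠ q in 𝓝 ((0 : EuclideanSpace ℝ (Fin 1)), x),
          (G q.1).h.inner q.2 = d.h.inner q.2 ∧ (G q.1).k q.2 = d.k q.2) ∧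
      ∀ c ≠ 0, ∃ e : AFEnd X, e.IsSoleEnd ∧ IsHarmonicallyFlatEnd e (G c)

/-- FIRST LEMMA of card `fire-the-pulse-into-the-far-field` — **tame ends are scale-free small to
every order.** For an admissible datum which is harmonically flat on the end `e`, every chart
derivative of `h − δ` and of `k` is, on the far annuli `{R/2 < ‖x‖ < 4R}`, eventually smaller than
`ε R^{-m}` resp. `ε R^{-m-1}` — for EVERY order `m` (the DR rates of `admissibleVacuumData` give
this only for `m ≤ 2` resp. `m ≤ 1`). This is the regularity the incoming-cone data of a short-pulse
/ Luk–Rodnianski characteristic problem fired into the far field must have. -/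
def TameEndScaleFreeSmall : Prop :=
  ∀ (X : Type) [TopologicalSpace X] [ChartedSpace E3 X] [IsManifold (𝓡 3) ∞ X]
    (D : InitialDataSet (𝓡 3) X) (e : AFEnd X), D ∈ admissibleVacuumData X →
    IsHarmonicallyFlatEnd e D → ∀ (m : ℕ) (ε : ℝ), 0 < ε → ∃ R₀ : ℝ, e.R < R₀ ∧
      ∀ R : ℝ, R₀ ≤ R → ∀ x : E3, R / 2 < ‖x‖ → ‖x‖ < 4 * R →
        ‖iteratedFDeriv ℝ m (fun y ↦ AFEnd.hCoeff e D y - innerSL ℝ) x‖ ≤ ε * R ^ (-(m : ℝ)) ∧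
        ‖iteratedFDeriv ℝ m (AFEnd.kCoeff e D) x‖ ≤ ε * R ^ (-(m : ℝ) - 1)

/-- The open coordinate annulus `{ρ₀ < ‖x‖ < ρ₁} ⊂ E3` (an open submanifold of `E3`). -/
def annulus (ρ₀ ρ₁ : ℝ) : TopologicalSpace.Opens E3 :=
  ⟨{x | ρ₀ < ‖x‖ ∧ ‖x‖ < ρ₁},
    (isOpen_lt continuous_const continuous_norm).inter (isOpen_lt continuous_norm continuous_const)⟩

/-- FIRST LEMMA of card `pump-the-mass-radially` — **toy: a time-symmetric vacuum collar pumping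
the mass from `m₀` to `m₁ > m₀`.** On the coordinate annulus `{ρ₀ < ‖x‖ < ρ₁}` (isotropic radii,
`ρ₀ > 2 m₁`, `ρ₁ > 8 ρ₀`) there is a time-symmetric (`k = 0`) solution of the vacuum constraints
(i.e. a scalar-flat metric) which IS the isotropic Schwarzschild(`m₀`) slice `(1 + m₀/2r)⁴ δ` near
the inner boundary and IS the isotropic Schwarzschild(`m₁`) slice near the outer boundary. Engine:
Bartnik's quasi-spherical parabolic construction (JDG 37 (1993)) — the shear of the foliation pumps
the quasi-local mass monotonically — followed by Corvino's localized gluing to exact Schwarzschild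
(CMP 214 (2000)). The card's real collar is the `k ≠ 0` version (Rácz's parabolic–hyperbolic
system, arXiv:1508.01810 Thm 4.1) ending on a TRAPPED Kerr–Schild slice. -/
def SchwarzschildMassPumpingCollar : Prop :=
  ∀ (m₀ m₁ ρ₀ ρ₁ : ℝ), 0 < m₀ → m₀ < m₁ → 2 * m₁ < ρ₀ → 8 * ρ₀ < ρ₁ →
    ∃ D : InitialDataSet (𝓡 3) (annulus ρ₀ ρ₁),
      (∀ [D.metric.HasLeviCivita], D.IsVacuumConstraintSolution) ∧
      (∀ x, D.k x = 0) ∧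
      (∀ x : annulus ρ₀ ρ₁, ‖(x : E3)‖ < 2 * ρ₀ → ∀ v w : E3,
        D.h.inner x v w = (1 + m₀ / (2 * ‖(x : E3)‖)) ^ 4 * ⟪v, w⟫_ℝ) ∧
      (∀ x : annulus ρ₀ ρ₁, ρ₁ / 2 < ‖(x : E3)‖ → ∀ v w : E3,
        D.h.inner x v w = (1 + m₁ / (2 * ‖(x : E3)‖)) ^ 4 * ⟪v, w⟫_ℝ)

/-- Sanity: the three first lemmas are propositions over existing declarations; and the crux they
serve is the route decl (by name). -/
example : Prop := ParametricHarmonicTaming ∧ TameEndScaleFreeSmall ∧ SchwarzschildMassPumpingCollar →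
  Summit.FinalStateConjecture.FinalStateConjecture.Theses.SwallowTheDatum.UniversalWitnessFamily

/-- The transfer `C⁺` of card `tame-the-end-first`: **the crux for TAME FAMILIES.** Given an
admissible datum `d` and a smooth admissible one-parameter family `G` through it, frozen at `d`
near every point for small parameters and harmonically flat on a sole end for every `c ≠ 0` (the
output of `ParametricHarmonicTaming`), there is a witness family `F` through `d` as the crux asks
(smooth, injective, admissible, full typed conclusion `P (F c)` for `c ≠ 0`). Easier than the crux
because every burial engine (Hintz's `E`-conormal gluing, Corvino–Schoen / Li–Mei matching,
characteristic short-pulse data, Rácz's radial system) now acts on a far field that is a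
ten-parameter real-analytic object instead of an `o₂(r⁻¹)/o₁(r⁻²)` one. -/
def UniversalWitnessFamilyTame : Prop :=
  ∀ (X : Type) [TopologicalSpace X] [ChartedSpace E3 X] [IsManifold (𝓡 3) ∞ X] [T2Space X]
    [SecondCountableTopology X] [ConnectedSpace X],
    ∀ d ∈ admissibleVacuumData X, ∀ G : EuclideanSpace ℝ (Fin 1) → InitialDataSet (𝓡 3) X,
      InitialDataSet.IsSmoothDataFamily 1 G → G 0 = d → (∀ c, G c ∈ admissibleVacuumData X) →
      (∀ x : X, ∀ᶠ q in 𝓝 ((0 : EuclideanSpace ℝ (Fin 1)), x),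
          (G q.1).h.inner q.2 = d.h.inner q.2 ∧ (G q.1).k q.2 = d.k q.2) →
      (∀ c ≠ 0, ∃ e : AFEnd X, e.IsSoleEnd ∧ IsHarmonicallyFlatEnd e (G c)) →
      ∃ F : EuclideanSpace ℝ (Fin 1) → InitialDataSet (𝓡 3) X,
        InitialDataSet.IsSmoothDataFamily 1 F ∧ F 0 = d ∧ Function.Injective F ∧
        (∀ c, F c ∈ admissibleVacuumData X) ∧
        ∀ c ≠ 0, (∃ 𝒟 : VacuumCauchyDevelopment (F c), 𝒟.IsMaximal) ∧
          ∀ 𝒟 : VacuumCauchyDevelopment (F c), 𝒟.IsMaximal →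
            Summit.FinalStateConjecture.HasCompleteNullInfinity 𝒟.toCauchyDevelopment ∧
            ∃ (O : Set 𝒟.carrier) (dec : FinalStateDecomposition 𝒟.toSpacetime O 2),
              (∀ i, Kerr.IsSubextremal (dec.mass i) (dec.spin i)) ∧
              O = Summit.FinalStateConjecture.exteriorOf 𝒟.toCauchyDevelopment dec.charted ∧
              Summit.FinalStateConjecture.HasExhaustiveCharts dec

/-- **The transfer is exact (pure logic, sorry-free):** taming plus the crux for tame families
gives the crux, by name. -/
theorem universalWitnessFamily_of_taming (hT : ParametricHarmonicTaming)
    (hB : UniversalWitnessFamilyTame) :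
    Summit.FinalStateConjecture.FinalStateConjecture.Theses.SwallowTheDatum.UniversalWitnessFamily := by
  intro X _ _ _ _ _ _ d hd
  obtain ⟨G, hG, h0, hadm, hfrozen, htame⟩ := hT X d hd
  exact hB X d hd G hG h0 hadm hfrozen htame

end Summit.FinalStateConjecture.FinalStateConjecture.Cruxes.UniversalWitnessFamily.Ideator3

end
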